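import Mathlib
import HarnessLib
import Summits.NavierStokesRegularity.NavierStokesRegularity.Theorems.TaylorModelRungThreeCertificateIntervalDJets

/-!
# Crux K1b-DR (stmt-NavierStokesRegularity-23954), line `taylor-model` — certificate SOUNDNESS tooling: INTERVAL JETS, part 3 —
# jet DIFFERENCES over a base box and a difference box (the `JD` / R2 enclosure of VECTOR-LEMMAS-23954 §2 (D1); dss_58 (B))

The Lohner-transport clauses of the v3 step are phrased WITHOUT flow derivatives (ns-tm-g4's `…SoundnessVectorDiff`,
`abs_diff_sub_taylor_le`): they consume an enclosure `JD k c ∋ T (y + d) k c − T y k c` of the jet DIFFERENCES for a base point `y`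
in the state box and a displacement `d` in a difference box — a quantity that scales with `|d|`, unlike the difference of two jet
enclosures. For a field `Q` additive in each slot (read through an additive coordinate functional `rd`) the differences
`D_k := T y' k − T y k` obey `(k+1)·D_{k+1} = Σ_{i≤k} [Q (T y i) D_{k-i} + Q D_i (T y (k-i)) + Q D_i D_{k-i}]`, so their interval
extension along the state levels `J` is `diffJetStep QB prec J JD k c`; `IsDiffJetEnclosure` (containment of that step in the next
level) and `mem_diffJet_of_isDiffJetEnclosure`: `rd (T y' k) c − rd (T y k) c ∈ JD k c` for all `k ≤ K` whenever `rd y ∈ J 0` and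
`rd y' − rd y ∈ JD 0` (no box hypothesis on `y'`). Box read-outs `mem_diffJet_of_mem_Icc` / `abs_diffJet_le_mag_of_mem_Icc` at
`V = ι → ℝ`.

MODEL-lattice bookkeeping only (rung TL-M3, one finite-dimensional model ODE); nothing here concerns the Navier–Stokes equations.
-/

-- the sub-problem namespace repeats the summit name by design (D-0017)
set_option linter.dupNamespace false

namespace Summit.NavierStokesRegularity.NavierStokesRegularity.Theorems.TaylorModelCert

open scoped BigOperators

namespace IntervalD

section Diff

variable {V : Type*} [AddCommGroup V] {σ : Type*} (rd : V → σ → ℝ) (Q : V → V → V) {T : V → ℕ → V}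

/-- The rounded interval evaluation of the jet-DIFFERENCE recursion: level `k+1`, coordinate `c`, from the state levels `J` and
the difference levels `0..k` of `JD`: `(Σ_{m≤k} (QB (J m) (JD (k-m)) c + QB (JD m) (J (k-m)) c + QB (JD m) (JD (k-m)) c)) / (k+1)`.
[folklore] -/
def diffJetStep (QB : (σ → IntervalD) → (σ → IntervalD) → σ → IntervalD) (prec : ℕ) (J JD : ℕ → σ → IntervalD) (k : ℕ)
    (c : σ) : IntervalD :=
  divNat prec (rangeSumR prec (fun m =>
    addR prec (addR prec (QB (J m) (JD (k - m)) c) (QB (JD m) (J (k - m)) c)) (QB (JD m) (JD (k - m)) c)) (k + 1)) (k + 1)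

/-- `JD` is a JET-DIFFERENCE ENCLOSURE up to order `K` along the state levels `J`: each level `k+1 ≤ K` contains the rounded
interval evaluation of the difference recursion. [folklore] -/
def IsDiffJetEnclosure (QB : (σ → IntervalD) → (σ → IntervalD) → σ → IntervalD) (prec K : ℕ) (J JD : ℕ → σ → IntervalD) :
    Prop :=
  ∀ k < K, ∀ (c : σ) (x : ℝ), mem x (diffJetStep QB prec J JD k c) → mem x (JD (k + 1) c)

variable {rd Q}

/-- **The interval extension of the difference recursion encloses the jet differences**: for `Q` additive in each slot and an
additive reader `rd`, if `QB` is an interval extension of `Q`, `J` a jet enclosure and `JD` a jet-difference enclosure along `J`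
up to order `K`, `rd y ∈ J 0` and `rd y' − rd y ∈ JD 0`, then `rd (T y' k) c − rd (T y k) c ∈ JD k c` for all `k ≤ K`.
[folklore; cite: Moore 1966 Ch. 3 (inclusion property)] -/
theorem mem_diffJet_of_isDiffJetEnclosure (hQl : ∀ a d b, Q (a + d) b = Q a b + Q d b)
    (hQr : ∀ a b e, Q a (b + e) = Q a b + Q a e) (hrd : ∀ x z c, rd (x + z) c = rd x c + rd z c)
    (hT0 : ∀ x c, rd (T x 0) c = rd x c)
    (hTs : ∀ x (k : ℕ) c, ((k : ℝ) + 1) * rd (T x (k + 1)) c =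
      ∑ i ∈ Finset.range (k + 1), rd (Q (T x i) (T x (k - i))) c)
    {QB : (σ → IntervalD) → (σ → IntervalD) → σ → IntervalD} (hQB : IsFieldEnclosure rd Q QB)
    {prec K : ℕ} {J JD : ℕ → σ → IntervalD} (hJ : IsJetEnclosure QB prec K J) (hJD : IsDiffJetEnclosure QB prec K J JD)
    {y y' : V} (hy : ∀ c, mem (rd y c) (J 0 c)) (hd : ∀ c, mem (rd y' c - rd y c) (JD 0 c)) :
    ∀ k ≤ K, ∀ c, mem (rd (T y' k) c - rd (T y k) c) (JD k c) := by
  have hT := mem_jet_of_isJetEnclosure hT0 hTs hQB hJ hy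
  -- the reader of a difference
  have hsub : ∀ x z c, rd (x - z) c = rd x c - rd z c := fun x z c => by
    have h := hrd (x - z) z c; rw [sub_add_cancel] at h; linarith
  intro k
  induction k using Nat.strong_induction_on with
  | _ k ih =>
    intro hk c
    cases k with
    | zero => rw [hT0, hT0]; exact hd c
    | succ k =>
      have hlev : ∀ m ≤ k, ∀ c, mem (rd (T y' m - T y m) c) (JD m c) := fun m hm c => by
        rw [hsub]; exact ih m (Nat.lt_succ_of_le hm) (le_trans (Nat.le_succ_of_le hm) hk) c
      -- expansion of the difference of the two recursions
      have hterm : ∀ i, rd (Q (T y' i) (T y' (k - i))) c - rd (Q (T y i) (T y (k - i))) c =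
          rd (Q (T y i) (T y' (k - i) - T y (k - i))) c + rd (Q (T y' i - T y i) (T y (k - i))) c +
            rd (Q (T y' i - T y i) (T y' (k - i) - T y (k - i))) c := by
        intro i
        have e1 : T y' i = T y i + (T y' i - T y i) := by abel
        have e2 : T y' (k - i) = T y (k - i) + (T y' (k - i) - T y (k - i)) := by abel
        conv_lhs => rw [e1, e2]
        rw [hQl, hQr, hQr, hrd, hrd, hrd]
        ring
      have hrec : rd (T y' (k + 1)) c - rd (T y (k + 1)) c = (∑ i ∈ Finset.range (k + 1),
          (rd (Q (T y i) (T y' (k - i) - T y (k - i))) c + rd (Q (T y' i - T y i) (T y (k - i))) c +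
            rd (Q (T y' i - T y i) (T y' (k - i) - T y (k - i))) c)) / ((k + 1 : ℕ) : ℝ) := by
        rw [eq_div_iff (by positivity), ← Finset.sum_congr rfl fun i _ => hterm i, Finset.sum_sub_distrib,
          ← hTs y' k c, ← hTs y k c]
        push_cast; ring
      rw [hrec]
      refine hJD k (Nat.lt_of_succ_le hk) c _ ?_
      refine mem_divNat prec (mem_rangeSumR prec (k + 1) fun m hm => ?_) (Nat.succ_pos k)
      have hTm := hT m (le_trans (Nat.le_of_lt_succ hm) ((Nat.le_succ k).trans hk))
      have hTkm := hT (k - m) (le_trans (Nat.sub_le k m) ((Nat.le_succ k).trans hk))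
      have hDm := hlev m (Nat.le_of_lt_succ hm)
      have hDkm := hlev (k - m) (Nat.sub_le k m)
      exact mem_addR prec (mem_addR prec (hQB _ _ _ _ hTm hDkm c) (hQB _ _ _ _ hDm hTkm c)) (hQB _ _ _ _ hDm hDkm c)

/-- **Box form, interval read-out** at `V = ι → ℝ`: base points `y ∈ [lo, hi]` with corners in `J 0`, displacements
`d ∈ [loD, hiD]` with corners in `JD 0` ⇒ `T (y + d) k c − T y k c ∈ JD k c` for all `k ≤ K`. [folklore] -/
theorem mem_diffJet_of_mem_Icc {ι : Type*} {Q : (ι → ℝ) → (ι → ℝ) → ι → ℝ} {T : (ι → ℝ) → ℕ → ι → ℝ}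
    (hQl : ∀ a d b, Q (a + d) b = Q a b + Q d b) (hQr : ∀ a b e, Q a (b + e) = Q a b + Q a e)
    (hT0 : ∀ x, T x 0 = x)
    (hTs : ∀ x (k : ℕ) c, ((k : ℝ) + 1) * T x (k + 1) c = ∑ i ∈ Finset.range (k + 1), Q (T x i) (T x (k - i)) c)
    {QB : (ι → IntervalD) → (ι → IntervalD) → ι → IntervalD} (hQB : IsFieldEnclosure (fun (y : ι → ℝ) (c : ι) => y c) Q QB)
    {prec K : ℕ} {J JD : ℕ → ι → IntervalD} (hJ : IsJetEnclosure QB prec K J) (hJD : IsDiffJetEnclosure QB prec K J JD)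
    {lo hi loD hiD : ι → ℝ} (hlo : ∀ c, mem (lo c) (J 0 c)) (hhi : ∀ c, mem (hi c) (J 0 c))
    (hloD : ∀ c, mem (loD c) (JD 0 c)) (hhiD : ∀ c, mem (hiD c) (JD 0 c)) :
    ∀ y ∈ Set.Icc lo hi, ∀ d ∈ Set.Icc loD hiD, ∀ k ≤ K, ∀ c, mem (T (y + d) k c - T y k c) (JD k c) := by
  intro y hy d hdd k hk c
  refine mem_diffJet_of_isDiffJetEnclosure (rd := fun (y : ι → ℝ) (c : ι) => y c) (T := T) hQl hQr (fun x z c => rfl)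
    (fun x c => by rw [hT0]) hTs hQB hJ hJD (fun c => mem_of_le_of_le (hlo c) (hhi c) (hy.1 c) (hy.2 c)) (fun c => ?_) k hk c
  simpa using mem_of_le_of_le (hloD c) (hhiD c) (hdd.1 c) (hdd.2 c)

/-- **Box form, magnitude read-out** (the `hJ` of `abs_diff_sub_taylor_le` in box form): under the same hypotheses,
`|T (y + d) (p+1) c − T y (p+1) c| ≤ mag (JD (p+1) c)`. [folklore] -/
theorem abs_diffJet_le_mag_of_mem_Icc {ι : Type*} {Q : (ι → ℝ) → (ι → ℝ) → ι → ℝ} {T : (ι → ℝ) → ℕ → ι → ℝ}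
    (hQl : ∀ a d b, Q (a + d) b = Q a b + Q d b) (hQr : ∀ a b e, Q a (b + e) = Q a b + Q a e)
    (hT0 : ∀ x, T x 0 = x)
    (hTs : ∀ x (k : ℕ) c, ((k : ℝ) + 1) * T x (k + 1) c = ∑ i ∈ Finset.range (k + 1), Q (T x i) (T x (k - i)) c)
    {QB : (ι → IntervalD) → (ι → IntervalD) → ι → IntervalD} (hQB : IsFieldEnclosure (fun (y : ι → ℝ) (c : ι) => y c) Q QB)
    {prec p : ℕ} {J JD : ℕ → ι → IntervalD} (hJ : IsJetEnclosure QB prec (p + 1) J)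
    (hJD : IsDiffJetEnclosure QB prec (p + 1) J JD)
    {lo hi loD hiD : ι → ℝ} (hlo : ∀ c, mem (lo c) (J 0 c)) (hhi : ∀ c, mem (hi c) (J 0 c))
    (hloD : ∀ c, mem (loD c) (JD 0 c)) (hhiD : ∀ c, mem (hiD c) (JD 0 c)) :
    ∀ y ∈ Set.Icc lo hi, ∀ d ∈ Set.Icc loD hiD, ∀ c, |T (y + d) (p + 1) c - T y (p + 1) c| ≤ (mag (JD (p + 1) c)).toReal :=
  fun y hy d hdd c => abs_le_mag (mem_diffJet_of_mem_Icc hQl hQr hT0 hTs hQB hJ hJD hlo hhi hloD hhiD y hy d hdd (p + 1)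
    le_rfl c)

end Diff

end IntervalD

end Summit.NavierStokesRegularity.NavierStokesRegularity.Theorems.TaylorModelCert
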